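import Summits.QuantumFields.YangMills.Theorems.UnitScaleTiltProp8ChartDoubleBarDeriv
import Summits.QuantumFields.YangMills.Theorems.UnitScaleTiltProp8ChartHInvComb
import Summits.QuantumFields.YangMills.Theorems.BalabanUVNodesK0Stub1StraightQTransposeLetter
import HarnessLib

/-!
# K0⁷ STUB 1 (`stub_prop8StepCoP13`), sub-target S4b — **THE DOUBLE-BAR CHART's LINEARISED AVERAGE `Qlin♭ = D(chartLogFlat η D)(0)` IN KERNEL FORM, AND ITS TWO CAPSTONE
# LETTERS (`hQ` with `q = L`, `hQt'` with `q₀ = 2` at `wB′ ≡ 1`) BY `exact`** — the bridge from the route UnitScaleTilt's `Prop8ChartDoubleBar.fderiv_chartLogFlat_zero_apply`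
# (`Qlin♭ Y (j,c) = (η·Lʲ)•Q_j(Y)(c)`, straight, no comb) to this seat's straight-average letters (p618789 `K0Stub1StraightQTransposeLetter`)

Cell `pub-ymgap`, width seat `pub-ymgap-k0-s1-w4` g0′ (FILE 9; reading (R1′) «♭ re-base» of k0-s1-w2 g4's LOCATED-BASEPOINT ∕ this seat's LOCATED-Q0-COMB).
`--kind proof --supports stmt-QuantumFields-20541 --as helper`; count-neutral.  [15] = [Balaban1985Variational]; [B5] = [Balaban1984PropagatorsI]; [B7] = [Balaban1985Averaging].

WHY.  With the SINGLE-bar chart the S4b capstone's transposed letters `q₀` (and `θ₀`) are not k-uniform (comb ∕ base-point modes).  The DOUBLE-bar chart of the route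
UnitScaleTilt (`Prop8ChartDoubleBarDefs.chartLogFlat`, [B7] Prop. 4's functional) linearises at the flat point to print's straight `(Lʲη)·Q_j` EXACTLY
(`fderiv_chartLogFlat_zero_apply`), i.e. to the rescaled straight average `(Lʲη)•Q_V` for which p618789 proves the capstone's `hQ` (`q = L`) and `hQt'` (`q₀ = 2`, `wB′ ≡ 1`,
for EVERY transpose `Qt` via uniqueness).  THIS FILE writes `Qlin♭` in p598821's kernel currency (`Σ_b (ν_t·Q_{j(t)}(t,b))•A b`, `ν_t = L^{j(t)}η`) and instantiates the two
letters, so a ♭-twin of p612123 (k0-s1-w2's seven `chartLog`-naming files) plugs them by `exact`.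

WHAT IS PROVED (sorry-free; no definition; axioms standard).
* §1 `bondAvgIter_eq_sum_single_smul` — `Q_j(A)(c) = Σ_b Q_j(e_b)(c)•A(b)` for matrix fields (generic `P`, `n`; UST `ChartHInv.bondAvgIter_kernel_apply`);
  ★★ `fderiv_chartLogFlat_zero_kernel` — `Qlin♭ A t = Σ_b ((L^{j(t)}η)·Q_{j(t)}(t,b))•A b` with `Q_{j}(t,b) = ofLp (QE D (toLp e_b)) t` (p598821's currency).
* §2 (generic carrier) ★★ `hQ_chartLogFlat_of_adm22` — p612123's `hQ` for `Q := Qlin♭` with `q = L` at every `Adm22 D R M` family with `2L ≤ R·M` (p618789 §4).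
* §3 (the record's tori) ★★★ `hQt'_chartLogFlat_unitWeight_T4` — for EVERY `Qt` with `BE (Qt X) δ = B X (Qlin♭ δ)` (p598821's `BE`, `B`; tracial `τ` with dualiser `ρ`):
  `(∀ i, 1·‖X i‖ ≤ s) → ∀ b, w 3 b·‖Qt X b‖ ≤ 2·s` (`0 ≤ s`) — p612123's `hQt'` AS DISPLAYED at `wB′ ≡ 1`, `q₀ = 2`, for the ♭ chart's own linearisation.
HONEST SCOPE.  First-order bookkeeping at the flat point over UST's double-bar calculus and p618789; nothing about the ♭ chart's nonlinear correction `D♭` ∕ `θ₀` (chart lane),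
nor about which chart the S4b lane finally adopts; nothing of Bałaban's analysis asserted; `stub_prop8StepCoP13` ∕ K0⁷ NOT closed; N07 NOT discharged; counts unmoved
(28∕28 · 5∕27); R4 closes the conditional finite-𝕋⁴ rung `BalabanLadder.UV` only, never the summit; the YM mass gap (Clay) is NOT proved by any of this; nothing continuum ∕
ℝ⁴ ∕ OS.  No `sorry`, no `def`, no `instance`, no `notation`.
References: [15] (20) p.281, (27) p.282, (44)–(45) p.285, (66) p.287, (87)–(88) p.291, (152) p.301; [B5] (1.11) p.19, (1.18) p.20; [B7] (125) p.36, (134) p.38;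
[Balaban1987RG1] (0.1) p.251.
-/

set_option autoImplicit false

noncomputable section

open scoped BigOperators Matrix.Norms.L2Operator

namespace Summit.QuantumFields.YangMills.Theorems.K0Stub1FlatChartQlinLetters

open Literature.MathematicalPhysics.QuantumFieldTheory.Balaban1983to89
open Literature.MathematicalPhysics.QuantumFieldTheory.Balaban1983to89.T4Continuum (T4Family)
open LatticeFieldCalculus (bondAvgIter)
open B6SectADomainsV1 (Domains)
open B6SectAOperatorsV1 (BondIdx QE)
open B9Eq39Adjoint (bondPair)
open Summit.QuantumFields.YangMills.Theorems.Prop8ChartDoubleBar (chartLogFlat fderiv_chartLogFlat_zero_apply)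
open Summit.QuantumFields.YangMills.Theorems.ChartHInv (bondAvgIter_kernel_apply)
open Summit.QuantumFields.YangMills.Theorems.FlatCubeOpsText (Adm22)
open Summit.QuantumFields.YangMills.Theorems.K0FlatCubeOpsTextP (IsLevWeight)
open Summit.QuantumFields.YangMills.Theorems.K0Stub1StraightQTransposeLetter (hQ_scaledStraight_of_adm22 hQt'_unitWeight_of_adjoint_T4)

/-! ## §1  The ♭ linearisation in kernel form -/

section Kernel

variable {P : Params} {n : Type*} [Fintype n] [DecidableEq n]

omit [Fintype n] [DecidableEq n] in
/-- **THE STRAIGHT AVERAGE OF A MATRIX FIELD THROUGH ITS REAL KERNEL**: `Q_j(A)(c) = Σ_b (Q_j e_b)(c)•A(b)` (`A = Σ_b e_b•A(b)`, UST `bondAvgIter_kernel_apply`).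
[cite: Balaban1984PropagatorsI, (1.11) p.19, (1.18) p.20] -/
theorem bondAvgIter_eq_sum_single_smul (j : ℕ) (A : PBond P 0 → Matrix n n ℂ) (c : PBond P j) :
    bondAvgIter j A c = ∑ b, ((bondAvgIter j (Pi.single b (1 : ℝ)) c : ℝ) : ℂ) • A b := by
  classical
  have hA : A = fun b' => ∑ b, (Pi.single b (1 : ℝ) : PBond P 0 → ℝ) b' • A b := by
    funext b'
    rw [Finset.sum_eq_single b' (fun b _ hb => by rw [Pi.single_eq_of_ne' hb, zero_smul]) (fun h => absurd (Finset.mem_univ _) h),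
      Pi.single_eq_same, one_smul]
  conv_lhs => rw [hA]
  rw [bondAvgIter_kernel_apply (fun b' b => (Pi.single b (1 : ℝ) : PBond P 0 → ℝ) b') A j c]
  exact Finset.sum_congr rfl fun b _ => by rw [Complex.coe_smul]

/-- ★★ **`Qlin♭` IN KERNEL FORM**: `(fderiv ℂ (chartLogFlat η D) 0 A)(t) = Σ_b ((L^{j(t)}η)·Q_{j(t)}(t,b))•A b`, `Q_{j}(t,b) = ofLp (QE D (toLp e_b)) t` — the rescaled straight
average `(Lʲη)•Q_V` of p618789 ∕ p598821, `ν_t = L^{j(t)}η`. [cite: Balaban1985Variational, (20) p.281, (44)-(45) p.285; Balaban1985Averaging, (125) p.36, (134) p.38] -/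
theorem fderiv_chartLogFlat_zero_kernel (η : ℝ) (D : Domains P) (A : PBond P 0 → Matrix n n ℂ) (t : BondIdx D) :
    fderiv ℂ (chartLogFlat η D : (PBond P 0 → Matrix n n ℂ) → BondIdx D → Matrix n n ℂ) 0 A t =
      ∑ b, ((((P.L : ℝ) ^ (t.1.1 : ℕ) * η) * WithLp.ofLp (QE D (WithLp.toLp 2 (Pi.single b 1))) t : ℝ) : ℂ) • A b := by
  rw [fderiv_chartLogFlat_zero_apply, bondAvgIter_eq_sum_single_smul, Finset.smul_sum]
  refine Finset.sum_congr rfl fun b _ => ?_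
  rw [smul_smul]
  congr 1
  have hq : WithLp.ofLp (QE D (WithLp.toLp 2 (Pi.single b 1))) t = bondAvgIter (t.1.1 : ℕ) (Pi.single b (1 : ℝ)) t.1.2 := rfl
  rw [hq]
  push_cast
  ring

end Kernel

/-! ## §2  The capstone's averaging letter `hQ` for `Qlin♭`, `q = L` (generic carrier) -/

/-- ★★ **p612123's `hQ` FOR THE ♭ CHART's LINEARISATION, `q = L`**: at every `Adm22 D R M` family with `2L ≤ R·M`, the (152) weights `w` (`IsLevWeight P k D w`, `D.k = k`):
`(∀ b, w 1 b·‖A′ b‖ ≤ r) → ∀ t, 1·‖(fderiv ℂ (chartLogFlat (L⁻¹)ᵏ D) 0 A′)(t)‖ ≤ L·r` (p618789 `hQ_scaledStraight_of_adm22` ∘ §1).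
[cite: Balaban1985Variational, (44)-(45) p.285, p.286; Balaban1984PropagatorsI, (1.18) p.20] -/
theorem hQ_chartLogFlat_of_adm22 {P : Params} {n : Type*} [Fintype n] [DecidableEq n] (k : ℕ) (D : Domains P) (hDk : D.k = k) {R M : ℕ} (hAdm : Adm22 D R M)
    (hRM : 2 * P.L ≤ R * M) {w : ℕ → PBond P 0 → ℝ} (hw : IsLevWeight P k D w)
    (A' : PBond P 0 → Matrix n n ℂ) (r : ℝ) (hA' : ∀ b, w 1 b * ‖A' b‖ ≤ r) (t : BondIdx D) :
    (1 : ℝ) * ‖fderiv ℂ (chartLogFlat (((P.L : ℝ)⁻¹) ^ k) D : (PBond P 0 → Matrix n n ℂ) → BondIdx D → Matrix n n ℂ) 0 A' t‖ ≤ (P.L : ℝ) * r :=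
  hQ_scaledStraight_of_adm22 k D hDk hAdm hRM hw
    (fun A => fderiv ℂ (chartLogFlat (((P.L : ℝ)⁻¹) ^ k) D : (PBond P 0 → Matrix n n ℂ) → BondIdx D → Matrix n n ℂ) 0 A)
    (fun A t' => fderiv_chartLogFlat_zero_kernel (((P.L : ℝ)⁻¹) ^ k) D A t') A' r hA' t

/-! ## §3  The capstone's `hQt'` for the transpose of `Qlin♭` at the record, `wB′ ≡ 1`, `q₀ = 2` -/

/-- ★★★ **p612123's `hQt'` AS DISPLAYED FOR THE ♭ CHART, UNIT BLOCK WEIGHT, `q₀ = 2`** — for every `F : T4Family`, `n, K`, nested family `D` with `D.k = K − n`, (152) weights,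
fibre `M_N(ℂ)` with a tracial `τ` and dualiser `ρ` (g0's `exists_fibreLetters`), the pairings `BE` = (27) and `B = Σ_t τ` (p598821's `hBE`, `hB`), and EVERY `Qt` with
`BE (Qt X) δ = B X (Qlin♭ δ)`, `Qlin♭ := fderiv ℂ (chartLogFlat (L⁻¹)^{K−n} D) 0` (the existential transpose a ♭-twin of p612123 would produce):
`(∀ i, 1·‖X i‖ ≤ s) → ∀ b, w 3 b·‖Qt X b‖ ≤ 2·s` (`0 ≤ s`) — p618789 `hQt'_unitWeight_of_adjoint_T4` ∘ §1, NO thresholds.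
[cite: Balaban1985Variational, (27) p.282, (44)-(45) p.285, (66) p.287, (152) p.301; Balaban1984PropagatorsI, (1.18) p.20; Balaban1987RG1, (0.1) p.251] -/
theorem hQt'_chartLogFlat_unitWeight_T4 {N : ℕ} [NeZero N] (F : T4Family) (n K : ℕ) (D : Domains (F.P K)) (hDk : D.k = K - n)
    {w : ℕ → PBond (F.P K) 0 → ℝ} (hw : IsLevWeight (F.P K) (K - n) D w)
    (τ : Matrix (Fin N) (Fin N) ℂ →L[ℂ] ℂ) (ρ : (Matrix (Fin N) (Fin N) ℂ →L[ℂ] ℂ) →L[ℂ] Matrix (Fin N) (Fin N) ℂ)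
    (hρ : ∀ (ℓ' : Matrix (Fin N) (Fin N) ℂ →L[ℂ] ℂ) (X : Matrix (Fin N) (Fin N) ℂ), τ (ρ ℓ' * X) = ℓ' X)
    (hτ : ∀ a b : Matrix (Fin N) (Fin N) ℂ, τ (a * b) = τ (b * a))
    (BE : (PBond (F.P K) 0 → Matrix (Fin N) (Fin N) ℂ) →L[ℂ] (PBond (F.P K) 0 → Matrix (Fin N) (Fin N) ℂ) →L[ℂ] ℂ)
    (hBE : ∀ Y δ : PBond (F.P K) 0 → Matrix (Fin N) (Fin N) ℂ, BE Y δ =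
      bondPair (((((F.P K).L : ℝ))⁻¹) ^ (K - n)) (F.P K).d (τ : Matrix (Fin N) (Fin N) ℂ →ₗ[ℂ] ℂ) (fun μ x => Y ⟨x, μ⟩) (fun μ x => δ ⟨x, μ⟩))
    (B : (BondIdx D → Matrix (Fin N) (Fin N) ℂ) →L[ℂ] (BondIdx D → Matrix (Fin N) (Fin N) ℂ) →L[ℂ] ℂ)
    (hB : ∀ X X' : BondIdx D → Matrix (Fin N) (Fin N) ℂ, B X X' = ∑ t, τ (X t * X' t))
    (Qt : (BondIdx D → Matrix (Fin N) (Fin N) ℂ) →L[ℂ] (PBond (F.P K) 0 → Matrix (Fin N) (Fin N) ℂ))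
    (hQt : ∀ X δ, BE (Qt X) δ =
      B X (fderiv ℂ (chartLogFlat (((((F.P K).L : ℝ))⁻¹) ^ (K - n)) D :
        (PBond (F.P K) 0 → Matrix (Fin N) (Fin N) ℂ) → BondIdx D → Matrix (Fin N) (Fin N) ℂ) 0 δ))
    (X : BondIdx D → Matrix (Fin N) (Fin N) ℂ) (s : ℝ) (hs : 0 ≤ s) (hX : ∀ i : BondIdx D, (1 : ℝ) * ‖X i‖ ≤ s) (b : PBond (F.P K) 0) :
    w 3 b * ‖Qt X b‖ ≤ 2 * s := by
  have hL0 : (0 : ℝ) < ((F.P K).L : ℝ) := by exact_mod_cast (F.P K).L_pos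
  exact hQt'_unitWeight_of_adjoint_T4 F n K D hDk hw τ ρ hρ hτ BE hBE B hB
    (fun t => ((F.P K).L : ℝ) ^ (t.1.1 : ℕ) * ((((F.P K).L : ℝ))⁻¹) ^ (K - n)) (fun t => le_of_eq (abs_of_nonneg (by positivity)))
    (fderiv ℂ (chartLogFlat (((((F.P K).L : ℝ))⁻¹) ^ (K - n)) D : (PBond (F.P K) 0 → Matrix (Fin N) (Fin N) ℂ) → BondIdx D → Matrix (Fin N) (Fin N) ℂ) 0)
    (fun A t => fderiv_chartLogFlat_zero_kernel (((((F.P K).L : ℝ))⁻¹) ^ (K - n)) D A t) Qt hQt X s hs hX b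

end Summit.QuantumFields.YangMills.Theorems.K0Stub1FlatChartQlinLetters

end
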